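import Summits.QuantumFields.YangMills.Theorems.IR.SCFloorTorusPeeling
import Summits.QuantumFields.YangMills.Theorems.IR.BetaSlopeFloorRungMoments
import Literature.NumberTheory.Sieve.BombieriAsymptoticSieveMertens

/-!
# Strong-coupling floor engine, part 5: the Mayer expansion of the doubled Wilson weight and its peeling

Pooled prover `ym-ir-line-bsf-p1` (crux `IR`, stmt-QuantumFields-19354; director-ym R366 pooled queue), support file for
`FacingPlaquetteCovFloor`.  On the doubled torus link configuration `W : Edge 4 L ⊕ Edge 4 L → G` write the doubled Wilson
weight as a Mayer product, `e^{−b(S(U)+S(U'))} = ∏_q (1 + g_q) = ∑_{Q} ∏_{q ∈ Q} g_q`, `g_q = e^{−b·dTerm_q} − 1`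
(`mayer_expansion`), so that the symmetrised doubled covariance numerator of two plaquette observables
`φ(hol_P)`, `φ(hol_P')` is a finite sum of **Mayer terms** `T_Q = ∫ Δφ_P Δφ_{P'} ∏_{q∈Q} g_q dπ`.

* `mayer_term_eq_zero` — **peeling**: if some bond of `P` is a bond of NO member of `Q` other than `P` itself (and not a
  bond of `P'`), then `T_Q = 0` (antisymmetric-pair peeling, part 3: that bond is read, in both copies, only through
  the antisymmetric pair factor `Δφ_P · (1 + g_P)`);
* `abs_mayerWeight_le`, `abs_prod_mayerWeight_le`, `abs_mayer_term_le` — the term of a polymer `Q` is `O(γ(b)^{|Q|})`,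
  `γ(b) = 2B|b|e^{2B|b|}` (`B` a bound on the plaquette cost), uniformly in everything.

Group-blind strong-coupling combinatorics on a finite torus; nothing here bears on the Yang–Mills mass gap.
-/

set_option autoImplicit false

noncomputable section

open MeasureTheory Filter Topology Function Finset
open Literature.MathematicalPhysics.QuantumFieldTheory

namespace Summit.QuantumFields.YangMills.Cruxes.IR.SCFloor

open BetaSlopeFloor (dTerm measurable_dTerm exists_bound_plaquetteCost measurable_inl_copy measurable_inr_copy
  wilsonAction_add_eq_sum_dTerm)

variable {L : ℕ} [NeZero L] {G : Type*} [Group G] [TopologicalSpace G] [IsTopologicalGroup G] [CompactSpace G]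
  [MeasurableSpace G] [BorelSpace G] {N : ℕ} (ρ : G →* Matrix (Fin N) (Fin N) ℂ)

/-! ## §1 The Mayer weight `g_q = e^{−b·dTerm_q} − 1` -/

omit [NeZero L] [TopologicalSpace G] [IsTopologicalGroup G] [CompactSpace G] [MeasurableSpace G] [BorelSpace G] in
/-- `dTerm` does not read bonds outside its plaquette (either copy). -/
theorem dTerm_update_of_not_mem {q : Plaquette 4 L} {ℓ : Edge 4 L}
    (hℓ : ℓ ∉ ({(q.1, q.2.1.1), (q.1.shift q.2.1.1, q.2.1.2), (q.1.shift q.2.1.2, q.2.1.1), (q.1, q.2.1.2)} :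
      Finset (Edge 4 L))) (W : Edge 4 L ⊕ Edge 4 L → G) (g : G) :
    dTerm ρ q (update W (Sum.inl ℓ) g) = dTerm ρ q W ∧ dTerm ρ q (update W (Sum.inr ℓ) g) = dTerm ρ q W := by
  constructor <;>
    simp only [dTerm, plaquetteCost, comp_inl_update_inl, comp_inr_update_inl, comp_inl_update_inr,
      comp_inr_update_inr, plaquetteHolonomy_update_of_not_mem hℓ]

omit [NeZero L] [TopologicalSpace G] [IsTopologicalGroup G] [CompactSpace G] [MeasurableSpace G] [BorelSpace G] in
/-- **Size of the Mayer weight**: `|e^{−b·dTerm_q} − 1| ≤ 2B|b| e^{2B|b|}` when `|plaquetteCost| ≤ B`. -/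
theorem abs_mayerWeight_le {B : ℝ} (hB : ∀ (U : GaugeConfig 4 L G) (p : Plaquette 4 L), |plaquetteCost ρ U p| ≤ B)
    (b : ℝ) (q : Plaquette 4 L) (W : Edge 4 L ⊕ Edge 4 L → G) :
    |Real.exp (-(b * dTerm ρ q W)) - 1| ≤ 2 * B * |b| * Real.exp (2 * B * |b|) := by
  have hd : |dTerm ρ q W| ≤ 2 * B := by
    unfold dTerm
    exact (abs_add_le _ _).trans (by linarith [hB (fun e => W (Sum.inl e)) q, hB (fun e => W (Sum.inr e)) q])
  have hx : |-(b * dTerm ρ q W)| ≤ 2 * B * |b| := by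
    rw [abs_neg, abs_mul]; nlinarith [abs_nonneg b]
  have hB0 : 0 ≤ 2 * B * |b| := le_trans (abs_nonneg _) hx
  calc |Real.exp (-(b * dTerm ρ q W)) - 1| ≤ |-(b * dTerm ρ q W)| * Real.exp |-(b * dTerm ρ q W)| :=
        Literature.NumberTheory.Sieve.BombieriSieve.abs_exp_sub_one_le _
    _ ≤ 2 * B * |b| * Real.exp (2 * B * |b|) :=
        mul_le_mul hx (Real.exp_le_exp.2 hx) (Real.exp_pos _).le hB0

omit [NeZero L] [TopologicalSpace G] [IsTopologicalGroup G] [CompactSpace G] [MeasurableSpace G] [BorelSpace G] in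
/-- A product of Mayer weights over `Q` is bounded by `γ^{|Q|}`, `γ = 2B|b|e^{2B|b|}`. -/
theorem abs_prod_mayerWeight_le {B : ℝ}
    (hB : ∀ (U : GaugeConfig 4 L G) (p : Plaquette 4 L), |plaquetteCost ρ U p| ≤ B)
    (b : ℝ) (Q : Finset (Plaquette 4 L)) (W : Edge 4 L ⊕ Edge 4 L → G) :
    |∏ q ∈ Q, (Real.exp (-(b * dTerm ρ q W)) - 1)| ≤ (2 * B * |b| * Real.exp (2 * B * |b|)) ^ Q.card := by
  rw [Finset.abs_prod]
  calc ∏ q ∈ Q, |Real.exp (-(b * dTerm ρ q W)) - 1| ≤ ∏ _q ∈ Q, (2 * B * |b| * Real.exp (2 * B * |b|)) :=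
        Finset.prod_le_prod (fun _ _ => abs_nonneg _) (fun q _ => abs_mayerWeight_le ρ hB b q W)
    _ = _ := Finset.prod_const _

variable [SecondCountableTopology G]

omit [NeZero L] [CompactSpace G] in
/-- The Mayer weight is measurable. -/
theorem measurable_mayerWeight (hρ : Continuous ρ) (b : ℝ) (q : Plaquette 4 L) :
    Measurable fun W : Edge 4 L ⊕ Edge 4 L → G => Real.exp (-(b * dTerm ρ q W)) - 1 :=
  (((measurable_dTerm ρ hρ q).const_mul b).neg.exp).sub measurable_const

omit [NeZero L] [CompactSpace G] in
/-- A product of Mayer weights is measurable. -/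
theorem measurable_prod_mayerWeight (hρ : Continuous ρ) (b : ℝ) (Q : Finset (Plaquette 4 L)) :
    Measurable fun W : Edge 4 L ⊕ Edge 4 L → G => ∏ q ∈ Q, (Real.exp (-(b * dTerm ρ q W)) - 1) :=
  Finset.measurable_prod _ fun q _ => measurable_mayerWeight ρ hρ b q

/-! ## §2 The Mayer expansion of the doubled Wilson weight -/

omit [SecondCountableTopology G] [TopologicalSpace G] [IsTopologicalGroup G] [CompactSpace G] [MeasurableSpace G]
  [BorelSpace G] in
/-- **Mayer expansion**: `e^{b·(−(S(U)+S(U')))} = ∑_{Q ⊆ plaquettes} ∏_{q ∈ Q} (e^{−b·dTerm_q} − 1)`. -/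
theorem mayer_expansion (b : ℝ) (W : Edge 4 L ⊕ Edge 4 L → G) :
    Real.exp (b * -(wilsonAction ρ (fun e => W (Sum.inl e)) + wilsonAction ρ (fun e => W (Sum.inr e)))) =
      ∑ Q ∈ (Finset.univ : Finset (Plaquette 4 L)).powerset, ∏ q ∈ Q, (Real.exp (-(b * dTerm ρ q W)) - 1) := by
  rw [wilsonAction_add_eq_sum_dTerm, ← Finset.prod_one_add]
  simp only [add_sub_cancel, mul_neg, ← Real.exp_sum, Finset.mul_sum, Finset.sum_neg_distrib]

/-! ## §4 Size of a Mayer term -/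

omit [SecondCountableTopology G] in
/-- **Size of a Mayer term**: `|∫ F · ∏_{q∈Q} g_q dπ| ≤ C γ^{|Q|}` for `|F| ≤ C`. -/
theorem abs_mayer_term_le {B : ℝ}
    (hB : ∀ (U : GaugeConfig 4 L G) (p : Plaquette 4 L), |plaquetteCost ρ U p| ≤ B) (b : ℝ)
    (Q : Finset (Plaquette 4 L)) {F : (Edge 4 L ⊕ Edge 4 L → G) → ℝ} {C : ℝ} (hF : ∀ W, |F W| ≤ C) :
    |∫ W, F W * ∏ q ∈ Q, (Real.exp (-(b * dTerm ρ q W)) - 1)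
        ∂(Measure.pi fun _ : Edge 4 L ⊕ Edge 4 L => haarProbability G)| ≤
      C * (2 * B * |b| * Real.exp (2 * B * |b|)) ^ Q.card := by
  have hC : 0 ≤ C := (abs_nonneg _).trans (hF fun _ => 1)
  refine (abs_integral_le_integral_abs).trans ?_
  calc ∫ W, |F W * ∏ q ∈ Q, (Real.exp (-(b * dTerm ρ q W)) - 1)|
        ∂(Measure.pi fun _ : Edge 4 L ⊕ Edge 4 L => haarProbability G)
      ≤ ∫ _W, C * (2 * B * |b| * Real.exp (2 * B * |b|)) ^ Q.card
        ∂(Measure.pi fun _ : Edge 4 L ⊕ Edge 4 L => haarProbability G) := by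
        refine integral_mono_of_nonneg (Eventually.of_forall fun _ => abs_nonneg _) (integrable_const _)
          (Eventually.of_forall fun W => ?_)
        dsimp only
        rw [abs_mul]
        exact mul_le_mul (hF W) (abs_prod_mayerWeight_le ρ hB b Q W) (abs_nonneg _) hC
    _ = C * (2 * B * |b| * Real.exp (2 * B * |b|)) ^ Q.card := by simp


/-! ## §3 Peeling kills Mayer terms that leave a bond of an observed plaquette uncovered -/

variable [Fact (1 < L)] [T2Space G]

/-- **Peeling of Mayer terms.**  Let `P = (x; 1,2)` and `P' = (x'; 1,2)` be plaquettes of the 4-torus, `φ` continuous,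
and let `ℓ` be a bond of `P` which is not a bond of `P'` and not a bond of any member of `Q` other than `P`.  Then the
Mayer term `∫ (φ(hol_P U) − φ(hol_P U')) (φ(hol_{P'} U) − φ(hol_{P'} U')) ∏_{q ∈ Q} (e^{−b·dTerm_q} − 1) dπ` vanishes:
the two copies of `ℓ` are read only through the antisymmetric pair factor `Δφ_P · (1 + g_P)^{[P ∈ Q]}` (part 3). -/
theorem mayer_term_eq_zero (hρ : Continuous ρ) {φ : G → ℝ} (hφ : Continuous φ) (x x' : Site 4 L) (b : ℝ)
    (Q : Finset (Plaquette 4 L)) {ℓ : Edge 4 L}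
    (hℓ : ℓ ∈ ({(x, (1 : Fin 4)), (x.shift 1, (2 : Fin 4)), (x.shift 2, (1 : Fin 4)), (x, (2 : Fin 4))} :
      Finset (Edge 4 L)))
    (hℓ' : ℓ ∉ ({(x', (1 : Fin 4)), (x'.shift 1, (2 : Fin 4)), (x'.shift 2, (1 : Fin 4)), (x', (2 : Fin 4))} :
      Finset (Edge 4 L)))
    (hQ : ∀ q ∈ Q, q ≠ (x, ⟨((1 : Fin 4), (2 : Fin 4)), by decide⟩) →
      ℓ ∉ ({(q.1, q.2.1.1), (q.1.shift q.2.1.1, q.2.1.2), (q.1.shift q.2.1.2, q.2.1.1), (q.1, q.2.1.2)} :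
        Finset (Edge 4 L))) :
    ∫ W, (φ (plaquetteHolonomy (fun e => W (Sum.inl e)) x 1 2) - φ (plaquetteHolonomy (fun e => W (Sum.inr e)) x 1 2)) *
        (φ (plaquetteHolonomy (fun e => W (Sum.inl e)) x' 1 2) -
          φ (plaquetteHolonomy (fun e => W (Sum.inr e)) x' 1 2)) *
        ∏ q ∈ Q, (Real.exp (-(b * dTerm ρ q W)) - 1)
      ∂(Measure.pi fun _ : Edge 4 L ⊕ Edge 4 L => haarProbability G) = 0 := by
  classical
  set P : Plaquette 4 L := (x, ⟨((1 : Fin 4), (2 : Fin 4)), by decide⟩) with hP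
  obtain ⟨B, -, hB⟩ := exists_bound_plaquetteCost (L := L) ρ hρ
  obtain ⟨Cφ, hCφ⟩ := isCompact_univ.exists_bound_of_continuousOn hφ.continuousOn
  have hCφ' : ∀ g, |φ g| ≤ Cφ := fun g => Real.norm_eq_abs _ ▸ hCφ g (Set.mem_univ g)
  -- the pair factor attached to `P`: `Δφ · (1 + g_P)` if `P ∈ Q`, `Δφ` otherwise
  set s : G → G → ℝ := fun h h' =>
    if P ∈ Q then Real.exp (-(b * (((N : ℝ) - (ρ h).trace.re) + ((N : ℝ) - (ρ h').trace.re)))) - 1 else 1 with hs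
  have hs_symm : ∀ h h', s h h' = s h' h := by intro h h'; simp only [hs, add_comm]
  set A : G → G → ℝ := fun h h' => (φ h - φ h') * s h h' with hA
  set R : (Edge 4 L ⊕ Edge 4 L → G) → ℝ := fun W =>
    (φ (plaquetteHolonomy (fun e => W (Sum.inl e)) x' 1 2) - φ (plaquetteHolonomy (fun e => W (Sum.inr e)) x' 1 2)) *
      ∏ q ∈ Q.erase P, (Real.exp (-(b * dTerm ρ q W)) - 1) with hR
  -- the integrand is `A(hol_P U, hol_P U') · R`
  have hsplit : ∀ W : Edge 4 L ⊕ Edge 4 L → G,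
      (φ (plaquetteHolonomy (fun e => W (Sum.inl e)) x 1 2) - φ (plaquetteHolonomy (fun e => W (Sum.inr e)) x 1 2)) *
        (φ (plaquetteHolonomy (fun e => W (Sum.inl e)) x' 1 2) -
          φ (plaquetteHolonomy (fun e => W (Sum.inr e)) x' 1 2)) *
        ∏ q ∈ Q, (Real.exp (-(b * dTerm ρ q W)) - 1) =
      A (plaquetteHolonomy (fun e => W (Sum.inl e)) x 1 2) (plaquetteHolonomy (fun e => W (Sum.inr e)) x 1 2) * R W := by
    intro W
    have hdP : dTerm ρ P W =
        ((N : ℝ) - (ρ (plaquetteHolonomy (fun e => W (Sum.inl e)) x 1 2)).trace.re) +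
          ((N : ℝ) - (ρ (plaquetteHolonomy (fun e => W (Sum.inr e)) x 1 2)).trace.re) := rfl
    by_cases hPQ : P ∈ Q
    · rw [← Finset.mul_prod_erase Q _ hPQ, hdP]
      simp only [hA, hs, hR, if_pos hPQ]
      ring
    · have hQe : Q.erase P = Q := Finset.erase_eq_of_notMem hPQ
      simp only [hA, hs, hR, if_neg hPQ, hQe]
      ring
  simp_rw [hsplit]
  refine integral_antisymm_pair_eq_zero x (show (1 : Fin 4) ≠ 2 by decide) hℓ (A := A) ?_ ?_ (R := R) ?_
    (CR := 2 * Cφ * (2 * B * |b| * Real.exp (2 * B * |b|)) ^ (Q.erase P).card) ?_ ?_ ?_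
  · -- continuity of the pair factor
    have hc : Continuous fun h : G => (N : ℝ) - (ρ h).trace.re := continuous_const.sub (continuous_trace_re ρ hρ)
    simp only [hA, hs]
    by_cases hPQ : P ∈ Q <;> simp only [hPQ, if_true, if_false] <;> fun_prop
  · intro a a'; simp only [hA, hs_symm a a']; ring
  · exact (((hφ.measurable.comp ((measurable_plaquetteHolonomy x' 1 2).comp measurable_inl_copy)).sub
      (hφ.measurable.comp ((measurable_plaquetteHolonomy x' 1 2).comp measurable_inr_copy))).mul
      (measurable_prod_mayerWeight ρ hρ b _))
  · intro W
    have hΔ : ∀ h h' : G, |φ h - φ h'| ≤ 2 * Cφ := fun h h' =>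
      (abs_sub _ _).trans (by linarith [hCφ' h, hCφ' h'])
    have hC0 : 0 ≤ 2 * Cφ := by linarith [abs_nonneg (φ 1), hCφ' 1]
    simp only [hR, abs_mul]
    exact mul_le_mul (hΔ _ _) (abs_prod_mayerWeight_le ρ hB b _ W) (abs_nonneg _) hC0
  · intro W g
    simp only [hR, comp_inl_update_inl, comp_inr_update_inl, plaquetteHolonomy_update_of_not_mem hℓ']
    congr 1
    refine Finset.prod_congr rfl fun q hq => ?_
    rw [(dTerm_update_of_not_mem ρ (hQ q (Finset.mem_of_mem_erase hq) (Finset.ne_of_mem_erase hq)) W g).1]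
  · intro W g
    simp only [hR, comp_inl_update_inr, comp_inr_update_inr, plaquetteHolonomy_update_of_not_mem hℓ']
    congr 1
    refine Finset.prod_congr rfl fun q hq => ?_
    rw [(dTerm_update_of_not_mem ρ (hQ q (Finset.mem_of_mem_erase hq) (Finset.ne_of_mem_erase hq)) W g).2]


end Summit.QuantumFields.YangMills.Cruxes.IR.SCFloor

end
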